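import Summits.QuantumFields.BalabanUV.T4Continuum.Support.NE1pFamilyBudget
import Summits.QuantumFields.BalabanUV.T4Continuum.Support.T4StepLawTransport

/-!
# `T4Continuum.NE1pFamilyBudgetFn` — THE FAMILY FORMAT (F-fam) at FUNCTION level and its two honest readings (spine estimate NE1′
# (node O3b/H2), cell `pub-balaban`, sub-cell `t4`; tree target `Summits/QuantumFields/BalabanUV/T4Continuum/Support/`; ADDITIVE —
# imports `NE1pFamilyBudget` and `T4StepLawTransport` ONLY, modifies nothing)

AUTHORSHIP AND PROVENANCE.  Written by the NE1′ IDEATION seat t4-ne1p-p2, generation 29 (planner-b2b-balaban-t4-ne1p-p2-g29-0,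
2026-08-20), as the HOME-staged kernel scratch `t4/b2b-balaban-t4-ne1p-p2-g29/work/NE1pFamilyBudgetG29.Sketch.lean` (sha16
48f458f1bb357834, 555 l., farm rc 0 · 0 sorry; ideation seats do not file under `Summits/`).  COURIERED into the tree by the row
OWNER t4-ne1p-p1, generation 23 (prover-b2b-balaban-t4-ne1p-p1-g23-0), as the owner's FORMAT RULING on the synthesis wall's
consolidated ask (`t4/ideate/NE1p-WALL.md` §5: F-fam ∕ F-II″ ∕ F-fam-2): the family-indexed format IS ADMITTED into the row's
pipeline, and the history weight it cannot hide (`card_le_sumH`) is booked at the ROOT as the budget form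
(`Spine/NE1p/DressedRootFam.lean`).  Changes from the scratch: namespace `PubBalaban.T4.NE1pFamilyBudgetG29` →
`Summit.QuantumFields.BalabanUV.T4Continuum.NE1pFamilyBudget`, split into two modules at the 400-line limit (this = §1–§2 booking
level; `NE1pFamilyBudgetFn` = §3–§4 function level + readings), headers; declarations and proofs BYTE-IDENTICAL otherwise.

CONTENTS.
* §3 function level: `cont_of_contStepLawOn_famRate` ∕ `cont_of_contStepLawLipOn_famRate` (`hdom : … ≤ α b k`),
  `moduliAt_of_birth_cont_fam` (birth constant `C₀ b`, rate `α b`), `transportsFromVarFam_of_moduliAt`,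
  `transportsFromVarFam_of_moduli` — the E-free chain with family rates, feeding §1 of `NE1pFamilyBudget`.
* §4 the two honest readings as corollaries: `transportsFromVarFam_dom` (a history domination `stepProd (α b) k′ k ≤ H b·stepProd ᾱ
  k′ k` moves the family dependence into the CONSTANT `C b·H b` at a uniform rate — and then §2's weighted count is exactly where
  `H` reappears) and `dressedBudgetFam_closed_genZero` (route W5-C, no within-family regeneration: the compatibility is
  `ρ b k·σ b k ≤ σ b (k+1)` alone and a family birth constant enters only `BirthsFromOldFam`, i.e. is paid AT BIRTH against the
  class); `AbsorbsFromFam` ∕ `birthsFromOldFam_of_absorbsFromFam` ∕ `hcompat_of_uniform_paid` (family absorption constants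
  `A b ≤ Ā` ⇒ UNIFORM classes survive the birth).

HONEST FRAMING.  Finite four-torus, rung (B)+1 only — NOT infinite volume, NOT a mass gap, NOT Clay, NOT summit progress.
«continuum YM on T⁴ ⇐ BetaPertH ∧ nine spine estimates (0/9 proved); BetaPertH ⇐ (D1) ∧ (D4) ∧ CAP+tail; G-an2-4 gates asym,
D1 and NE2/3/4».  [folklore] arithmetic and induction cloned from the tree's own theorems (named below) with indices added;
0 sorry, 0 citations; nothing of Bałaban's densities or the cell's D-terms is asserted — every transport / regeneration / birth /
count / class statement stays a HYPOTHESIS about the cell's instantiation.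
-/

namespace Summit.QuantumFields.BalabanUV.T4Continuum.NE1pFamilyBudget

open Finset
open Literature.MathematicalPhysics.QuantumFieldTheory.Balaban1983to89
open T4TermFormat T4TermFormat.Booking T4GatedBooking T4TrajectoryComparison T4TrajectoryComparison.Trajectory
open T4TrajectoryModulus
open Summit.QuantumFields.BalabanUV.T4Continuum.T4TrajectoryDensityDressed
open Summit.QuantumFields.BalabanUV.T4Continuum.T4StepLawTransport

noncomputable section

/-! ## §3 Function level: family rates through the E-free chain -/

section FunctionLevel

variable {B : Booking} {T : Trajectory B}
variable {𝒰 F : Type*} [NormedAddCommGroup F]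

/-- **THE CONTINUATION BINDER FROM PER-FAMILY STEP LAWS WITH A FAMILY RATE** —
`T4TrajectoryDensityPerFamily.cont_of_contStepLawOn_fam` VERBATIM except `hdom : a b k + ℓ b k′ k·ω b k′ k ≤ α b k`
(the met component's `ℓ` no longer forced under one uniform `α k`). [folklore] -/
theorem cont_of_contStepLawOn_famRate {Z : Type*} {Gate : ℕ → Prop} {Fn : B.Birth → ℕ → ℕ → 𝒰 → F}
    {Adm : B.Birth → ℕ → ℕ → 𝒰 → 𝒰 → ℝ → Prop} {𝒢 : B.Birth → ℕ → Set (Z → F)}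
    {E : B.Birth → ℕ → 𝒰 → (Z → F) → F} {act : B.Birth → ℕ → Z → 𝒰 → 𝒰} {D : B.Birth → ℕ → Set Z}
    {a α : B.Birth → ℕ → ℝ} {ℓ ω : B.Birth → ℕ → ℕ → ℝ} {w : ℝ}
    (hAdm : ∀ b k' k U₀ U₁ δ, Adm b k' k U₀ U₁ δ → 0 ≤ δ)
    (hFn : ∀ (b : B.Birth) (k' k : ℕ), B.birthScale b ≤ k' → k' ≤ k → k + 1 ≤ B.K → RanBelow Gate (k + 1) →
      ∀ U, Fn b k' (k + 1) U = E b k U (fun z => Fn b k' k (act b k z U)))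
    (h𝒢 : ∀ (b : B.Birth) (k' k : ℕ), B.birthScale b ≤ k' → k' ≤ k → k + 1 ≤ B.K → RanBelow Gate (k + 1) →
      ∀ U, (fun z => Fn b k' k (act b k z U)) ∈ 𝒢 b k)
    (hlaw : ∀ (b : B.Birth) (k' k : ℕ), B.birthScale b ≤ k' → k' ≤ k → k + 1 ≤ B.K → RanBelow Gate (k + 1) →
      ContStepLawOn (𝒢 b k) (E b k) (act b k) (D b k) (Adm b k' (k + 1)) (Adm b k' k) w (a b k) (ℓ b k' k) (ω b k' k))
    (hdom : ∀ (b : B.Birth) (k' k : ℕ), B.birthScale b ≤ k' → k' ≤ k → k + 1 ≤ B.K →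
      a b k + ℓ b k' k * ω b k' k ≤ α b k) :
    ∀ (b : B.Birth) (k' k : ℕ), B.birthScale b ≤ k' → k' ≤ k → k + 1 ≤ B.K → RanBelow Gate (k + 1) →
      ∀ M : ℝ, 0 ≤ M → RespMod (Fn b k' k) (Adm b k' k) w M →
        RespMod (Fn b k' (k + 1)) (Adm b k' (k + 1)) w (α b k * M) := by
  intro b k' k hbk' hk'k hk hran M hM hG
  have h := ((hlaw b k' k hbk' hk'k hk hran).respMod_continue (h𝒢 b k' k hbk' hk'k hk hran) hM hG).congr_fun
    (hFn b k' k hbk' hk'k hk hran)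
  exact h.mono (hAdm b k' (k + 1)) (mul_le_mul_of_nonneg_right (hdom b k' k hbk' hk'k hk) hM)

/-- **THE SAME IN TRANSPORT CURRENCY** — `T4StepLawTransport.cont_of_contStepLawLipOn_fam` VERBATIM except
`hdom : a b k + ℓ b k′ k·κ b k′ k ≤ α b k`. [folklore] -/
theorem cont_of_contStepLawLipOn_famRate {Z : Type*} {Gate : ℕ → Prop} {Fn : B.Birth → ℕ → ℕ → 𝒰 → F}
    {Adm : B.Birth → ℕ → ℕ → 𝒰 → 𝒰 → ℝ → Prop} {𝒢 : B.Birth → ℕ → Set (Z → F)}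
    {E : B.Birth → ℕ → 𝒰 → (Z → F) → F} {act : B.Birth → ℕ → Z → 𝒰 → 𝒰} {D : B.Birth → ℕ → Set Z}
    {dZ : B.Birth → ℕ → Z → Z → ℝ} {a α : B.Birth → ℕ → ℝ} {ℓ κ : B.Birth → ℕ → ℕ → ℝ} {w : ℝ}
    (hAdm : ∀ b k' k U₀ U₁ δ, Adm b k' k U₀ U₁ δ → 0 ≤ δ)
    (hFn : ∀ (b : B.Birth) (k' k : ℕ), B.birthScale b ≤ k' → k' ≤ k → k + 1 ≤ B.K → RanBelow Gate (k + 1) →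
      ∀ U, Fn b k' (k + 1) U = E b k U (fun z => Fn b k' k (act b k z U)))
    (h𝒢 : ∀ (b : B.Birth) (k' k : ℕ), B.birthScale b ≤ k' → k' ≤ k → k + 1 ≤ B.K → RanBelow Gate (k + 1) →
      ∀ U, (fun z => Fn b k' k (act b k z U)) ∈ 𝒢 b k)
    (hlaw : ∀ (b : B.Birth) (k' k : ℕ), B.birthScale b ≤ k' → k' ≤ k → k + 1 ≤ B.K → RanBelow Gate (k + 1) →
      ContStepLawLipOn (𝒢 b k) (E b k) (act b k) (D b k) (dZ b k) (Adm b k' (k + 1)) (Adm b k' k) w (a b k)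
        (ℓ b k' k) (κ b k' k))
    (hdom : ∀ (b : B.Birth) (k' k : ℕ), B.birthScale b ≤ k' → k' ≤ k → k + 1 ≤ B.K →
      a b k + ℓ b k' k * κ b k' k ≤ α b k) :
    ∀ (b : B.Birth) (k' k : ℕ), B.birthScale b ≤ k' → k' ≤ k → k + 1 ≤ B.K → RanBelow Gate (k + 1) →
      ∀ M : ℝ, 0 ≤ M → RespMod (Fn b k' k) (Adm b k' k) w M →
        RespMod (Fn b k' (k + 1)) (Adm b k' (k + 1)) w (α b k * M) := by
  intro b k' k hbk' hk'k hk hran M hM hG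
  have h := ((hlaw b k' k hbk' hk'k hk hran).respMod_continue (h𝒢 b k' k hbk' hk'k hk hran) hM hG).congr_fun
    (hFn b k' k hbk' hk'k hk hran)
  exact h.mono (hAdm b k' (k + 1)) (mul_le_mul_of_nonneg_right (hdom b k' k hbk' hk'k hk) hM)

/-- **FAMILY BIRTH CONSTANTS + FAMILY-RATE CONTINUATION ⇒ FAMILY MODULI AT EVERY SCALE** —
`T4TrajectoryModulus.moduliAt_of_birth_cont_dep` VERBATIM with `C₀ b` and `α b k` (the induction is along ONE family).
[folklore] -/
theorem moduliAt_of_birth_cont_fam {Gate : ℕ → Prop} {Fn : B.Birth → ℕ → ℕ → 𝒰 → F}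
    {Adm : B.Birth → ℕ → ℕ → 𝒰 → 𝒰 → ℝ → Prop} {C₀ : B.Birth → ℝ} {w : ℝ} {α : B.Birth → ℕ → ℝ}
    (hC₀ : ∀ b, 0 ≤ C₀ b) (hα : ∀ b i, 0 ≤ α b i)
    (hbirth : ∀ (b : B.Birth) (k' : ℕ), B.birthScale b ≤ k' → k' ≤ B.K → RanBelow Gate k' →
      RespMod (Fn b k' k') (Adm b k' k') w (C₀ b * T.gen b k'))
    (hcont : ∀ (b : B.Birth) (k' k : ℕ), B.birthScale b ≤ k' → k' ≤ k → k + 1 ≤ B.K → RanBelow Gate (k + 1) →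
      ∀ M : ℝ, 0 ≤ M → RespMod (Fn b k' k) (Adm b k' k) w M →
        RespMod (Fn b k' (k + 1)) (Adm b k' (k + 1)) w (α b k * M)) :
    ∀ (b : B.Birth) (k' k : ℕ), B.birthScale b ≤ k' → k' ≤ k → k ≤ B.K → RanBelow Gate k →
      RespMod (Fn b k' k) (Adm b k' k) w (C₀ b * stepProd (α b) k' k * T.gen b k') := by
  have key : ∀ (b : B.Birth) (k' : ℕ), B.birthScale b ≤ k' → ∀ n : ℕ, k' + n ≤ B.K → RanBelow Gate (k' + n) →
      RespMod (Fn b k' (k' + n)) (Adm b k' (k' + n)) w (C₀ b * stepProd (α b) k' (k' + n) * T.gen b k') := by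
    intro b k' hbk' n
    induction n with
    | zero =>
      intro hk hran
      rw [Nat.add_zero] at hk hran ⊢
      exact (hbirth b k' hbk' hk hran).congr_const (by rw [stepProd_self, mul_one])
    | succ n ih =>
      intro hk hran
      have hk1 : k' + n + 1 ≤ B.K := by omega
      have hranS : RanBelow Gate (k' + n + 1) := hran
      have hM : 0 ≤ C₀ b * stepProd (α b) k' (k' + n) * T.gen b k' :=
        mul_nonneg (mul_nonneg (hC₀ b) (stepProd_nonneg (hα b) _ _)) (T.gen_nonneg b k')
      have h := hcont b k' (k' + n) hbk' (Nat.le_add_right _ _) hk1 hranS _ hM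
        (ih (by omega) (hranS.mono (by omega)))
      have heq : α b (k' + n) * (C₀ b * stepProd (α b) k' (k' + n) * T.gen b k') =
          C₀ b * stepProd (α b) k' (k' + n + 1) * T.gen b k' := by
        rw [stepProd_succ (α b) (Nat.le_add_right k' n)]; ring
      exact h.congr_const heq
  intro b k' k hbk' hk'k hk hran
  obtain ⟨n, rfl⟩ := Nat.exists_eq_add_of_le hk'k
  exact key b k' hbk' n hk hran

/-- **FAMILY MODULI AT EVERY SCALE ⇒ `TransportsFromVarFam`** — `T4TrajectoryModulus.transportsFromVar_of_moduliAt_dep`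
VERBATIM with `C₀ b`, `α b`: `TransportsFromVarFam T (fun b => C₀ b·c_δ) (fun b i => ψ·α b i) Gate`. [folklore] -/
theorem transportsFromVarFam_of_moduliAt {Gate : ℕ → Prop} {Fn : B.Birth → ℕ → ℕ → 𝒰 → F}
    {Adm : B.Birth → ℕ → ℕ → 𝒰 → 𝒰 → ℝ → Prop} {defect : B.Birth → ℕ → ℕ → ℝ} {C₀ : B.Birth → ℝ} {cδ ψ w : ℝ}
    {α : B.Birth → ℕ → ℝ} (hC₀ : ∀ b, 0 ≤ C₀ b) (hα : ∀ b i, 0 ≤ α b i)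
    (hmod : ∀ (b : B.Birth) (k' k : ℕ), B.birthScale b ≤ k' → k' ≤ k → k ≤ B.K → RanBelow Gate k →
      RespMod (Fn b k' k) (Adm b k' k) w (C₀ b * stepProd (α b) k' k * T.gen b k'))
    (hdefw : ∀ b k' k, defect b k' k ≤ w)
    (hrate : ∀ (b : B.Birth) (k' k : ℕ), B.birthScale b ≤ k' → k' ≤ k → k ≤ B.K →
      defect b k' k ≤ cδ * ψ ^ (k - k'))
    (hlin : ∀ (b : B.Birth) (k' k : ℕ), B.birthScale b ≤ k' → k' ≤ k → k ≤ B.K → RanBelow Gate k → ∀ ε > 0,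
      ∃ U₀ U₁ : 𝒰, Adm b k' k U₀ U₁ (defect b k' k) ∧ T.lin b k' k ≤ ‖Fn b k' k U₁ - Fn b k' k U₀‖ + ε) :
    TransportsFromVarFam T (fun b => C₀ b * cδ) (fun b i => ψ * α b i) Gate := by
  intro b k' k hbk' hk'k hk hran
  refine le_of_forall_pos_le_add fun ε hε => ?_
  obtain ⟨U₀, U₁, hadm, hle⟩ := hlin b k' k hbk' hk'k hk hran ε hε
  have hresp := hmod b k' k hbk' hk'k hk hran U₀ U₁ _ hadm (hdefw b k' k)
  have hC₀b : 0 ≤ C₀ b := hC₀ b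
  have hP : 0 ≤ stepProd (α b) k' k := stepProd_nonneg (hα b) k' k
  have hg0 : 0 ≤ T.gen b k' := T.gen_nonneg b k'
  have hprod : stepProd (fun i => ψ * α b i) k' k = ψ ^ (k - k') * stepProd (α b) k' k := by
    rw [stepProd_mul (fun _ => ψ) (α b), stepProd_const]
  have hmono : C₀ b * stepProd (α b) k' k * T.gen b k' * defect b k' k ≤
      C₀ b * cδ * stepProd (fun i => ψ * α b i) k' k * T.gen b k' :=
    calc C₀ b * stepProd (α b) k' k * T.gen b k' * defect b k' k
        ≤ C₀ b * stepProd (α b) k' k * T.gen b k' * (cδ * ψ ^ (k - k')) :=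
          mul_le_mul_of_nonneg_left (hrate b k' k hbk' hk'k hk) (by positivity)
      _ = C₀ b * cδ * stepProd (fun i => ψ * α b i) k' k * T.gen b k' := by rw [hprod]; ring
  linarith

/-- **THE FAMILY RESPONSE-MODULUS FORMAT ⇒ `TransportsFromVarFam`** (`moduliAt_of_birth_cont_fam` ∘
`transportsFromVarFam_of_moduliAt`). [folklore] -/
theorem transportsFromVarFam_of_moduli {Gate : ℕ → Prop} {Fn : B.Birth → ℕ → ℕ → 𝒰 → F}
    {Adm : B.Birth → ℕ → ℕ → 𝒰 → 𝒰 → ℝ → Prop} {defect : B.Birth → ℕ → ℕ → ℝ} {C₀ : B.Birth → ℝ} {cδ ψ w : ℝ}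
    {α : B.Birth → ℕ → ℝ} (hC₀ : ∀ b, 0 ≤ C₀ b) (hα : ∀ b i, 0 ≤ α b i)
    (hbirth : ∀ (b : B.Birth) (k' : ℕ), B.birthScale b ≤ k' → k' ≤ B.K → RanBelow Gate k' →
      RespMod (Fn b k' k') (Adm b k' k') w (C₀ b * T.gen b k'))
    (hcont : ∀ (b : B.Birth) (k' k : ℕ), B.birthScale b ≤ k' → k' ≤ k → k + 1 ≤ B.K → RanBelow Gate (k + 1) →
      ∀ M : ℝ, 0 ≤ M → RespMod (Fn b k' k) (Adm b k' k) w M →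
        RespMod (Fn b k' (k + 1)) (Adm b k' (k + 1)) w (α b k * M))
    (hdefw : ∀ b k' k, defect b k' k ≤ w)
    (hrate : ∀ (b : B.Birth) (k' k : ℕ), B.birthScale b ≤ k' → k' ≤ k → k ≤ B.K →
      defect b k' k ≤ cδ * ψ ^ (k - k'))
    (hlin : ∀ (b : B.Birth) (k' k : ℕ), B.birthScale b ≤ k' → k' ≤ k → k ≤ B.K → RanBelow Gate k → ∀ ε > 0,
      ∃ U₀ U₁ : 𝒰, Adm b k' k U₀ U₁ (defect b k' k) ∧ T.lin b k' k ≤ ‖Fn b k' k U₁ - Fn b k' k U₀‖ + ε) :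
    TransportsFromVarFam T (fun b => C₀ b * cδ) (fun b i => ψ * α b i) Gate :=
  transportsFromVarFam_of_moduliAt hC₀ hα (moduliAt_of_birth_cont_fam hC₀ hα hbirth hcont) hdefw hrate hlin

end FunctionLevel

/-! ## §4 The two honest readings -/

section Readings

variable {B : Booking} {T : Trajectory B}

/-- **READING (I): A HISTORY DOMINATION MOVES THE FAMILY DEPENDENCE INTO THE CONSTANT.**  If the family rate products are
dominated by a weight times the uniform products, `stepProd (ρ b) k′ k ≤ H b·stepProd ρ̄ k′ k`, then family transport at rate
`ρ b` with constant `C b` IS transport at the UNIFORM rate `ρ̄` with the FAMILY constant `C b·H b` — whose envelopes are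
`H b ×` the uniform ones, so the classes carry `H b` and §2's gate needs the `H`-WEIGHTED count.  The booking cannot hide `H`.
[folklore] -/
theorem transportsFromVarFam_dom {C H : B.Birth → ℝ} {ρ : B.Birth → ℕ → ℝ} {ρbar : ℕ → ℝ} {Gate : ℕ → Prop}
    (hC : ∀ b, 0 ≤ C b) (h : TransportsFromVarFam T C ρ Gate)
    (hdom : ∀ b k' k, B.birthScale b ≤ k' → k' ≤ k → k ≤ B.K → stepProd (ρ b) k' k ≤ H b * stepProd ρbar k' k) :
    TransportsFromVarFam T (fun b => C b * H b) (fun _ => ρbar) Gate := by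
  intro b k' k hbk' hk'k hk hran
  show T.lin b k' k ≤ C b * H b * stepProd ρbar k' k * T.gen b k'
  calc T.lin b k' k ≤ C b * stepProd (ρ b) k' k * T.gen b k' := h b k' k hbk' hk'k hk hran
    _ ≤ C b * (H b * stepProd ρbar k' k) * T.gen b k' :=
        mul_le_mul_of_nonneg_right (mul_le_mul_of_nonneg_left (hdom b k' k hbk' hk'k hk) (hC b)) (T.gen_nonneg b k')
    _ = C b * H b * stepProd ρbar k' k * T.gen b k' := by ring

/-- The envelope is LINEAR in its constant: a family constant `C·H b` scales the uniform envelope by `H b`. [folklore] -/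
theorem envVar_const_mul (C H : ℝ) (ρ : ℕ → ℝ) (b : B.Birth) (k : ℕ) :
    T.envVar (C * H) ρ b k = H * T.envVar C ρ b k := by
  unfold Trajectory.envVar
  rw [mul_sum]
  refine sum_congr rfl fun k' _ => ?_
  ring

/-- **READING (II): ROUTE W5-C (merged offspring, NO within-family regeneration).**  With `gen b (k+1) = 0` the compatibility
is `ρ b k·σ b k ≤ σ b (k+1)` ALONE and the family birth constant `C b` enters ONLY `BirthsFromOldFam` — i.e. it is paid AT
BIRTH against the class (`C b·gen b j_b ≤ σ b j_b`), never re-imported by regeneration. [folklore] -/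
theorem dressedBudgetFam_closed_genZero {s₀ : B.Birth → ℕ → ℝ} {m : ℝ} {S : ℕ → B.Birth → Finset B.Birth}
    {C H : B.Birth → ℝ} {ρ σ : B.Birth → ℕ → ℝ} {A₀ ρ₁ τ Λ N₀ ρ' sbar : ℝ}
    (hC : ∀ b, 0 ≤ C b) (hρ : ∀ b k, 0 ≤ ρ b k)
    (hm : 0 ≤ m) (hA₀ : 0 ≤ A₀) (hρ₁ : 0 ≤ ρ₁) (hτ0 : 0 ≤ τ) (hτ1 : τ ≤ 1) (hΛ : 0 ≤ Λ) (hN₀ : 0 ≤ N₀)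
    (hρ'1 : ρ' < 1) (hprod : Λ * ρ₁ * τ ≤ ρ')
    (hS : ∀ k b, ∀ f ∈ S k b, B.birthScale f ≤ k)
    (hcountH : ∀ k b, ∀ j ≤ k, ∑ f ∈ (S k b).filter (fun f => B.birthScale f = j), H f ≤ N₀ * Λ ^ (k - j))
    (hσ : ∀ f k, B.birthScale f ≤ k → k < B.K →
      σ f k ≤ H f * (A₀ * ρ₁ ^ (k - B.birthScale f) * τ ^ (B.K - B.birthScale f)))
    (hs₀ : ∀ b k, s₀ b k ≤ sbar) (hsmall : m * (N₀ * A₀ * (1 - ρ')⁻¹) ≤ 1 - sbar)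
    (hgen0 : ∀ b k, B.birthScale b ≤ k → k < B.K → T.gen b (k + 1) = 0)
    (hbirth : BirthsFromOldFam T C ρ σ (budgetGateFam T s₀ m S C ρ))
    (hrate : ∀ b k, B.birthScale b ≤ k → k < B.K → ρ b k * σ b k ≤ σ b (k + 1))
    (htr : TransportsFromVarFam T C ρ (budgetGateFam T s₀ m S C ρ)) :
    ∀ k, k ≤ B.K → EnvBoundAtVarFam T C ρ σ k ∧ RanBelow (budgetGateFam T s₀ m S C ρ) k :=
  dressedBudgetFam_closed (c := fun _ _ => 0) hC hρ (fun _ _ => le_rfl) hm hA₀ hρ₁ hτ0 hτ1 hΛ hN₀ hρ'1 hprod hS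
    hcountH hσ hs₀ hsmall hbirth
    (fun b k hbk hk => by rw [mul_zero, add_zero]; exact hrate b k hbk hk) htr
    (fun b k hbk hk _ => by rw [hgen0 b k hbk hk, zero_mul])

/-! ### §4b Reading (II) continued: met steps as BIRTHS — a family ABSORPTION constant, paid once per offspring -/

/-- HYPOTHESIS SHAPE — ABSORPTION FORMAT WITH A FAMILY ABSORPTION CONSTANT `A b` (tree `AbsorbsFrom` is the constant case):
`C b·gen b j_b ≤ β j_b + A b·Σ_{b₀ ∈ S b} envVar (C b₀) (ρ b₀) b₀ j_b` under the history below `j_b`.  Dictionary (cell reading, NOT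
asserted): at a met component `Y` ALL live families felt there merge into ONE offspring `b` (route W5-C); on road P2 with exit (ε)
its absorption constant is the met-step modulus factor `A b = s(Y)·(a + 2Λ_k(Y)·ω)` — the oscillation-modulus tilt constant of
`NE1pRealTiltG28.bgLip_clause_of_oscMod` times the component's booked suppression share `s(Y)`; ONE payment per offspring, not per
absorbed family. [folklore] -/
def AbsorbsFromFam (T : Trajectory B) (C : B.Birth → ℝ) (ρ : B.Birth → ℕ → ℝ) (β : ℕ → ℝ) (A : B.Birth → ℝ)
    (S : B.Birth → Finset B.Birth) (Gate : ℕ → Prop) : Prop :=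
  ∀ b : B.Birth, B.birthScale b ≤ B.K → RanBelow Gate (B.birthScale b) →
    C b * T.gen b (B.birthScale b) ≤
      β (B.birthScale b) + A b * ∑ b₀ ∈ S b, T.envVar (C b₀) (ρ b₀) b₀ (B.birthScale b)

/-- CONSISTENCY — constant data IS the tree's `AbsorbsFrom`. [folklore] -/
theorem absorbsFromFam_const_iff {C A : ℝ} {ρ β : ℕ → ℝ} {S : B.Birth → Finset B.Birth} {Gate : ℕ → Prop} :
    AbsorbsFromFam T (fun _ => C) (fun _ => ρ) β (fun _ => A) S Gate ↔ T.AbsorbsFrom C ρ β A S Gate := Iff.rfl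

/-- **FAMILY ABSORPTION ⇒ FAMILY BIRTHS FROM OLD** (tree `birthsFromOld_of_absorbsFrom`, pointwise): absorbed families strictly
older, `A b ≥ 0`, and the per-offspring compatibility `β j_b + A b·Σ_{b₀ ∈ S b} σ b₀ j_b ≤ σ b j_b`. [folklore] -/
theorem birthsFromOldFam_of_absorbsFromFam {C A : B.Birth → ℝ} {ρ σ : B.Birth → ℕ → ℝ} {β : ℕ → ℝ}
    {S : B.Birth → Finset B.Birth} {Gate : ℕ → Prop}
    (hS : ∀ b b₀, b₀ ∈ S b → B.birthScale b₀ < B.birthScale b) (hA : ∀ b, 0 ≤ A b)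
    (h : AbsorbsFromFam T C ρ β A S Gate)
    (hcompat : ∀ b : B.Birth, B.birthScale b ≤ B.K →
      β (B.birthScale b) + A b * ∑ b₀ ∈ S b, σ b₀ (B.birthScale b) ≤ σ b (B.birthScale b)) :
    BirthsFromOldFam T C ρ σ Gate := fun b hbK hran hold =>
  (h b hbK hran).trans ((add_le_add le_rfl (mul_le_mul_of_nonneg_left
    (sum_le_sum fun b₀ hb₀ => hold b₀ (hS b b₀ hb₀)) (hA b))).trans (hcompat b hbK))

/-- **THE PER-OFFSPRING COMPATIBILITY FROM A UNIFORM BOUND ON THE PAID CONSTANT**: if every offspring's (suppression-paid)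
absorption constant is `A b ≤ Ā`, the absorbed classes at its birth sum to at most `Σ̄ j_b` (the size-weighted positional count of
gen 26, `absorbed_classes_le`: `Σ̄ j = N·A₀·(1−ρ′)⁻¹·τ^{K−j}`), and the fresh diagonal absorbs `β j + Ā·Σ̄ j ≤ σ₀ j`, then the
compatibility holds with the UNIFORM class `σ b k := σ₀`-diagonal — no history weight survives the birth. [folklore] -/
theorem hcompat_of_uniform_paid {A : B.Birth → ℝ} {σ : B.Birth → ℕ → ℝ} {β Sbar σ₀ : ℕ → ℝ} {Abar : ℝ}
    {S : B.Birth → Finset B.Birth} (hA : ∀ b, 0 ≤ A b) (hAbar : ∀ b, A b ≤ Abar)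
    (hσsum : ∀ b, B.birthScale b ≤ B.K → ∑ b₀ ∈ S b, σ b₀ (B.birthScale b) ≤ Sbar (B.birthScale b))
    (hSbar : ∀ j, 0 ≤ Sbar j)
    (hdiag : ∀ b, B.birthScale b ≤ B.K → σ₀ (B.birthScale b) ≤ σ b (B.birthScale b))
    (hfeas : ∀ j, j ≤ B.K → β j + Abar * Sbar j ≤ σ₀ j) :
    ∀ b : B.Birth, B.birthScale b ≤ B.K →
      β (B.birthScale b) + A b * ∑ b₀ ∈ S b, σ b₀ (B.birthScale b) ≤ σ b (B.birthScale b) := by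
  intro b hbK
  calc β (B.birthScale b) + A b * ∑ b₀ ∈ S b, σ b₀ (B.birthScale b)
      ≤ β (B.birthScale b) + A b * Sbar (B.birthScale b) :=
        add_le_add le_rfl (mul_le_mul_of_nonneg_left (hσsum b hbK) (hA b))
    _ ≤ β (B.birthScale b) + Abar * Sbar (B.birthScale b) :=
        add_le_add le_rfl (mul_le_mul_of_nonneg_right (hAbar b) (hSbar _))
    _ ≤ σ₀ (B.birthScale b) := hfeas _ hbK
    _ ≤ σ b (B.birthScale b) := hdiag b hbK

end Readings

end

end Summit.QuantumFields.BalabanUV.T4Continuum.NE1pFamilyBudget
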